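import Summits.FinalStateConjecture.FinalStateConjecture.Statement
import Literature.Geometry.Lorentzian.CauchyDevelopment
import Literature.Geometry.Lorentzian.NullInfinity
import Literature.Geometry.Lorentzian.Isometry
import Literature.Geometry.Lorentzian.LeviCivitaProofs
import HarnessLib

/-!
# Transport of "rays stay in the closure" along an isometry of developments (registered stub
`stub_raysStayInClosure_transport`, line `Sketch` = tame template, crux
`EIHFluxBalance.ModulatedKerrHandoff`, item stmt-FinalStateConjecture-17402)

Let `𝒟₁`, `𝒟₂` be vacuum Cauchy developments of the same initial data set `D` on `X`, and let
`ψ : M₁ ≃ M₂` be a time-orientation preserving isometric diffeomorphism with `ψ ∘ ι₁ = ι₂` (the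
data of `CauchyDevelopment.IsIsometricTo`, i.e. of MGHD uniqueness up to isometry,
Choquet-Bruhat–Geroch 1969). GIVEN the ray correspondence (`γ` is a normalised future null ray of
`𝒟₁` from `p` on `dom` iff `ψ ∘ γ` is one of `𝒟₂`; a hypothesis here), clause (R)
`Summit.FinalStateConjecture.RaysStayInClosure` (`Statement.lean`: every future-complete
normalised null ray from the data stays in `closure O` for parameters `t ≥ 0`) transports from
`(𝒟₁, O)` to `(𝒟₂, ψ '' O)`: a ray `γ₂` of `𝒟₂` pulls back to the ray `ψ⁻¹ ∘ γ₂` of `𝒟₁`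
(the correspondence applied to `ψ ∘ (ψ⁻¹ ∘ γ₂) = γ₂`), which stays in `closure O`; hence
`γ₂ t = ψ (ψ⁻¹ (γ₂ t)) ∈ ψ '' closure O ⊆ closure (ψ '' O)` by continuity of `ψ`
(`image_closure_subset_closure_image`). The Levi-Civita instance of `g₁` needed to invoke the
hypothesis on `𝒟₁` is the existence theorem `PseudoRiemannianMetric.hasLeviCivita`
(`LeviCivitaProofs.lean`; O'Neill 1983, Ch. 3, Thm. 3.11).
Mathlib + the Literature cone only; no definitions, no named facts.
O'Neill, *Semi-Riemannian geometry* (1983), Ch. 3, pp. 60–61, 90–91.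
Stub-worker of the line lead prover-line-stmt-FinalStateConjecture-17402-0, 2026-08-17.
-/

-- the summit-side namespace `Summit.FinalStateConjecture.FinalStateConjecture.…` (summit = problem)
-- repeats a component by design, which the `dupNamespace` linter would flag on every decl.
set_option linter.dupNamespace false

noncomputable section

open scoped Manifold ContDiff Topology
open Set Function Literature.Geometry.Lorentzian

namespace Summit.FinalStateConjecture.FinalStateConjecture.Theorems.EIHFluxBalance.TameTemplate

/-- **Clause (R) "rays stay in the closure of `O`" transports along an isometry of developments**
(registered stub `stub_raysStayInClosure_transport` of line `Sketch`). For vacuum Cauchy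
developments `𝒟₁`, `𝒟₂` of `D`, a time-orientation preserving isometric diffeomorphism
`ψ : M₁ ≃ M₂` with `ψ ∘ ι₁ = ι₂`, and the ray correspondence (`ψ ∘ γ` is a normalised future
null ray of `𝒟₂` from `p` iff `γ` is one of `𝒟₁`) as a hypothesis:
`RaysStayInClosure 𝒟₁ O → RaysStayInClosure 𝒟₂ (ψ '' O)`. A ray `γ₂` of `𝒟₂` is `ψ ∘ γ₁` with
`γ₁ := ψ⁻¹ ∘ γ₂` a ray of `𝒟₁`, so `γ₂ t = ψ (γ₁ t) ∈ ψ '' closure O ⊆ closure (ψ '' O)`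
(`image_closure_subset_closure_image`, `ψ` continuous); the Levi-Civita instance of `g₁` is
`PseudoRiemannianMetric.hasLeviCivita`. [cite: ONeillSemiRiemannian1983, Ch. 3, pp. 90–91] -/
theorem stub_raysStayInClosure_transport : ∀ (X : Type) [TopologicalSpace X] [ChartedSpace E3 X] [IsManifold (𝓡 3) ((⊤ : ℕ∞) : WithTop ℕ∞) X] [T2Space X] [SecondCountableTopology X] [ConnectedSpace X] (D : InitialDataSet (𝓡 3) X) (𝒟₁ 𝒟₂ : VacuumCauchyDevelopment D) (ψ : Diffeomorph (𝓡 4) (𝓡 4) 𝒟₁.carrier 𝒟₂.carrier ((⊤ : ℕ∞) : WithTop ℕ∞)), 𝒟₁.metric.IsIsometry 𝒟₂.metric.toPseudoRiemannianMetric ψ → 𝒟₁.timeOrientation.PreservesTimeOrientation ψ 𝒟₂.timeOrientation → ψ ∘ 𝒟₁.embed = 𝒟₂.embed → (∀ [𝒟₁.metric.HasLeviCivita] [𝒟₂.metric.HasLeviCivita] (p : X) (γ : ℝ → 𝒟₁.carrier) (dom : Set ℝ), 𝒟₂.metric.IsNormalisedNullRayFrom 𝒟₂.timeOrientation 𝒟₂.embed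 𝒟₂.normal p (ψ ∘ γ) dom ↔ 𝒟₁.metric.IsNormalisedNullRayFrom 𝒟₁.timeOrientation 𝒟₁.embed 𝒟₁.normal p γ dom) → ∀ O : Set 𝒟₁.carrier, Summit.FinalStateConjecture.RaysStayInClosure 𝒟₁.toCauchyDevelopment O → Summit.FinalStateConjecture.RaysStayInClosure 𝒟₂.toCauchyDevelopment (ψ '' O) := by
  intro X _ _ _ _ _ _ D 𝒟₁ 𝒟₂ ψ _ _ _ hray O hR
  unfold Summit.FinalStateConjecture.RaysStayInClosure
  intro _ p γ₂ dom hγ₂ hdom t ht ht0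
  -- the Levi-Civita connection of the smooth metric `g₁` exists (O'Neill 1983, Thm. 3.11)
  haveI : 𝒟₁.metric.HasLeviCivita := 𝒟₁.metric.toPseudoRiemannianMetric.hasLeviCivita
  -- pull the ray back along `ψ⁻¹`
  set γ₁ : ℝ → 𝒟₁.carrier := (ψ.symm : 𝒟₂.carrier → 𝒟₁.carrier) ∘ γ₂
  have hc : (ψ : 𝒟₁.carrier → 𝒟₂.carrier) ∘ γ₁ = γ₂ :=
    funext fun s ↦ ψ.apply_symm_apply (γ₂ s)
  have hγ₁ : 𝒟₁.metric.IsNormalisedNullRayFrom 𝒟₁.timeOrientation 𝒟₁.embed 𝒟₁.normal p γ₁ dom :=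
    (hray p γ₁ dom).1 (hc ▸ hγ₂)
  have hmem : γ₁ t ∈ closure O := hR p γ₁ dom hγ₁ hdom t ht ht0
  have h₂ : γ₂ t = ψ (γ₁ t) := (ψ.apply_symm_apply (γ₂ t)).symm
  rw [h₂]
  exact image_closure_subset_closure_image ψ.continuous (mem_image_of_mem _ hmem)

end Summit.FinalStateConjecture.FinalStateConjecture.Theorems.EIHFluxBalance.TameTemplate

end
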